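import Literature.NumberTheory.GelbartRogawski1991.Prop311PrintedCML2AllSignatures
import Literature.NumberTheory.GelbartRogawski1991.Prop311PrintedFormRescalingMp
import Literature.NumberTheory.GelbartRogawski1991.Prop311PrintedTrivialModel
import Literature.NumberTheory.GelbartRogawski1991.Prop311RhoPsiL2Frame
import Literature.NumberTheory.GelbartRogawski1991.Prop311SkewHermitianOrthogonalBasis
import Literature.NumberTheory.Automorphic.AdeleAddCharClassification
import HarnessLib

-- buildfix G11b-3 recipe (LEDGER B13-1/B13-3): elaborate sequentially (dependent telescopes of the CM dual-pair datum).
set_option Elab.async false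

/-!
# [GelbartRogawski1991, Proposition 3.1.1] AS PRINTED — THE BODY OF `Prop311AsPrinted` AT CM DATA, EVERY `ψ`, EVERY MODEL

Topic `NumberTheory/GelbartRogawski1991`; namespace `Literature.NumberTheory.GelbartRogawski1991.Prop311`.  KERNEL ONLY:
one theorem; no definition, no named fact, no `sorry`; `Prop311AsPrinted` itself is untouched (nothing of it is assumed).

**`prop311AsPrinted_CM`.**  For a CM field `L` — the quadratic extension `E/F = L/L⁺` of number fields with its conjugation
(`IsCMField.complexConj`) — and, exactly as in the binders of the statement-exact typing `Prop311AsPrinted`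
([GelbartRogawski1991, §1.1 p. 449 L26–32, §3.1 p. 454 L17–42]): ANY non-trivial continuous character `ψ` of `F\𝐀`, ANY
skew-Hermitian space `(V, Φ)` over `L` with `φ = Tr Φ` non-degenerate, ANY irreducible unitary representation `ρ` of
`H_𝐀(W)` with central character `ψ` on ANY Hilbert space `S` (continuous orbit maps), and ANY rational splitting `i` of `π`
over `Sp_F(W)`, the CONCLUSION of [GelbartRogawski1991, Prop. 3.1.1 p. 455 L1–2] holds verbatim as rendered there:
(1) "`π` splits over `G(𝐀)`" and (2) "there exists a continuous section `s : G(𝐀) → Mp_𝐀(W)` such that `s(G(F))` is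
contained in `i(Sp_F(W))`".

Assembly (every piece a tree theorem):
* `S = 0`: `Prop311PrintedTrivialModel.conclusion_of_subsingleton`;
* `S ≠ 0`: Tate, `ψ = ψ_F(ξ ·)`, `ξ ∈ Fˣ` (`IsGlobalAddChar.exists_eq_mulShift_adeleAddChar`, [CasselsFrohlichANT1967, Ch. XV
  Thm 4.1.4]); rescale to `(V, ξΦ)` and the model `ρ ∘ τ_ξ` with central character `ψ_F` (`Prop311PrintedFormRescaling`,
  `comp_heisTwist_printed_binders`, `exists_isRationalSplitting_smul`); take a `ξΦ`-orthogonal basis with imaginary diagonal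
  (`exists_orthogonal_basis_imaginary`); the body of the proposition for the `L²(𝐀_Fⁿ)` model of `(V, ξΦ)`
  (`Prop311PrintedCML2AllSignatures.prop311_CM_L2'` — GR-2's `prop311_CM_L2`: the stage-1 kernel `GRConstruction.gru_shape`,
  Weil's unitary leg `adelicMpCont.unitaryLegL2`, the along-the-section socket; with the third hand's Steinhaus–Weil continuity
  for every signature and the irreducibility of the `L²` model from `Prop311RhoPsiL2Frame`); transport to the model `ρ ∘ τ_ξ` by the
  uniqueness of `ρ_ψ` (`Prop311ModelIndependence.conclusion_of_conclusion`); undo the rescaling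
  (`Prop311PrintedFormRescalingMp.conclusion_of_conclusion_smul`).

What is NOT covered (and not claimed): quadratic extensions `E/F` that are not CM (e.g. real quadratic), for which
`Prop311AsPrinted` is also stated; the CM case is the one consumed by the HodgeCM cell (`hGRU`).  HC_CM is not touched here.

## References
* [GelbartRogawski1991] S. Gelbart, J. Rogawski, Invent. Math. 105 (1991) 445–472, §1.1 p. 449 L26–32, §3.1 p. 454 L17–42,
  Prop. 3.1.1 p. 455 L1–2.
* [Weil1964] A. Weil, Acta Math. 111 (1964) 143–211, Chap. I n° 11–13, Chap. III n° 37–41.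
* [CasselsFrohlichANT1967] J. W. S. Cassels, A. Fröhlich (eds.), Algebraic Number Theory (1967), Ch. XV (Tate) Thm 4.1.4.
* [MoeglinVignerasWaldspurger1987] C. Mœglin, M.-F. Vignéras, J.-L. Waldspurger, LNM 1291 (1987), Chap. 2 I.1–II.1.
-/

set_option autoImplicit false

noncomputable section

open NumberField MeasureTheory Module
open scoped TensorProduct Matrix
open Literature.NumberTheory.Automorphic
open Literature.RepresentationTheory.HeisenbergGroup
open Literature.NumberTheory.Weil1964

namespace Literature.NumberTheory.GelbartRogawski1991

namespace Prop311

open UnitaryDualPair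

/-- **[GelbartRogawski1991, Proposition 3.1.1] AS PRINTED, AT CM DATA — for every non-trivial character `ψ` of `F\𝐀`, every
skew-Hermitian `(V, Φ)` over the CM field `L` (`F = L⁺`, `E = L`, conjugation `IsCMField.complexConj`), every irreducible
unitary model `ρ` of `ρ_ψ` on a Hilbert space and every rational splitting `i`** (the binders of `Prop311AsPrinted`): "(1) the
covering `π` splits over `G(𝐀)`; (2) there exists a continuous section `s : G(𝐀) → Mp_𝐀(W)` such that `s(G(F))` is contained in
`i(Sp_F(W))`", verbatim as rendered in `Prop311AsPrinted`.
[cite: GelbartRogawski1991, §3.1 Proposition 3.1.1, p. 455 L1–2; §1.1 p. 449 L26–32; §3.1 p. 454 L17–42]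
[cite: CasselsFrohlichANT1967, Ch. XV Thm 4.1.4] -/
theorem prop311AsPrinted_CM (L : Type) [Field L] [NumberField L] [IsCMField L]
    -- "ψ will denote a non-trivial additive character of F\𝐀" (p. 449 L32)
    (ψ : AddChar (AdeleRing (𝓞 ↥(maximalRealSubfield L)) ↥(maximalRealSubfield L)) Circle) (hψc : Continuous ψ)
    (hψF : ∀ x : ↥(maximalRealSubfield L),
      ψ (algebraMap (↥(maximalRealSubfield L)) (AdeleRing (𝓞 ↥(maximalRealSubfield L)) ↥(maximalRealSubfield L)) x) = 1)
    (hψ1 : ψ ≠ 1)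
    -- "(V, Φ) a skew Hermitian space, where V is an n-dimensional vector space over E" (p. 454 L37–42)
    (V : Type) [AddCommGroup V] [Module L V] [FiniteDimensional L V]
    (Φ : V →ₗ[↥(maximalRealSubfield L)] V →ₗ[↥(maximalRealSubfield L)] L)
    (hΦ₁ : ∀ (a : L) (x y : V), Φ (a • x) y = a * Φ x y)
    (hΦ₂ : ∀ (a : L) (x y : V), Φ x (a • y) = Φ x y * IsCMField.complexConj L a)
    (hΦ₃ : ∀ x y : V, Φ y x = -IsCMField.complexConj L (Φ x y))
    (hφ : (traceForm (↥(maximalRealSubfield L)) L V Φ).Nondegenerate)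
    -- "ρ_ψ an irreducible unitary representation of H_𝐀(W) with central character ψ" (p. 454 L20–21)
    (S : Type) [NormedAddCommGroup S] [InnerProductSpace ℂ S] [CompleteSpace S]
    (ρ : Representation ℂ (AdelicHeisenberg (↥(maximalRealSubfield L)) L V Φ) S)
    (hρu : ∀ (h : AdelicHeisenberg (↥(maximalRealSubfield L)) L V Φ) (f : S), ‖ρ h f‖ = ‖f‖)
    (hρc : ∀ f : S, @Continuous _ _ (heisenbergTopology (↥(maximalRealSubfield L)) L V Φ) _ fun h => ρ h f)
    (hρi : ∀ K : Submodule ℂ S, IsClosed (K : Set S) →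
      (∀ (h : AdelicHeisenberg (↥(maximalRealSubfield L)) L V Φ), ∀ f ∈ K, ρ h f ∈ K) → K = ⊥ ∨ K = ⊤)
    (hρz : ∀ (t : AdeleRing (𝓞 ↥(maximalRealSubfield L)) ↥(maximalRealSubfield L)) (f : S),
      ρ (Heisenberg.ofCenter (heisForm (↥(maximalRealSubfield L)) L V Φ) (Multiplicative.ofAdd t)) f =
        ((ψ t : Circle) : ℂ) • f)
    -- "π splits uniquely over … Sp_F(W). We denote this splitting by i." (p. 454 L35–36)
    (i : ratSp (↥(maximalRealSubfield L)) L V Φ →* adelicMp (↥(maximalRealSubfield L)) L V Φ ρ)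
    (hi : IsRationalSplitting (↥(maximalRealSubfield L)) L V Φ ρ i) :
    -- "Proposition 3.1.1. The covering π splits over G(𝐀)." (p. 455 L1)
    (∃ s : adelicUnitary (↥(maximalRealSubfield L)) L V Φ →* adelicMp (↥(maximalRealSubfield L)) L V Φ ρ,
        ∀ g : adelicUnitary (↥(maximalRealSubfield L)) L V Φ,
          projEnd (↥(maximalRealSubfield L)) L V Φ ρ (s g) =
            ((g : AdelicSpace (↥(maximalRealSubfield L)) V ≃ₗ[AdeleRing (𝓞 ↥(maximalRealSubfield L)) ↥(maximalRealSubfield L)]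
                AdelicSpace (↥(maximalRealSubfield L)) V) :
              AdelicSpace (↥(maximalRealSubfield L)) V →ₗ[AdeleRing (𝓞 ↥(maximalRealSubfield L)) ↥(maximalRealSubfield L)]
                AdelicSpace (↥(maximalRealSubfield L)) V)) ∧
    -- "There exists a continuous section s : G(𝐀) → Mp_𝐀(W) such that s(G(F)) is contained in i(Sp_F(W))." (p. 455 L1–2)
      ∃ s : adelicUnitary (↥(maximalRealSubfield L)) L V Φ →* adelicMp (↥(maximalRealSubfield L)) L V Φ ρ,
        Continuous s ∧
        (∀ g : adelicUnitary (↥(maximalRealSubfield L)) L V Φ,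
          projEnd (↥(maximalRealSubfield L)) L V Φ ρ (s g) =
            ((g : AdelicSpace (↥(maximalRealSubfield L)) V ≃ₗ[AdeleRing (𝓞 ↥(maximalRealSubfield L)) ↥(maximalRealSubfield L)]
                AdelicSpace (↥(maximalRealSubfield L)) V) :
              AdelicSpace (↥(maximalRealSubfield L)) V →ₗ[AdeleRing (𝓞 ↥(maximalRealSubfield L)) ↥(maximalRealSubfield L)]
                AdelicSpace (↥(maximalRealSubfield L)) V)) ∧
        ∀ g : adelicUnitary (↥(maximalRealSubfield L)) L V Φ,
          IsRationalPoint (↥(maximalRealSubfield L)) L V Φ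
              (g : AdelicSpace (↥(maximalRealSubfield L)) V ≃ₗ[AdeleRing (𝓞 ↥(maximalRealSubfield L)) ↥(maximalRealSubfield L)]
                AdelicSpace (↥(maximalRealSubfield L)) V) →
            s g ∈ i.range := by
  -- (0) the degenerate model `S = 0`
  by_cases hS : Nontrivial S
  swap
  · haveI : Subsingleton S := not_nontrivial_iff_subsingleton.1 hS
    exact conclusion_of_subsingleton (↥(maximalRealSubfield L)) L V Φ ρ i hi
  haveI : Nontrivial S := hS
  -- (1) Tate: `ψ = ψ_F(ξ ·)`
  -- (`have` before every `obtain`: `rcases` on a non-variable term generalizes it over this very large goal)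
  have hψg : IsGlobalAddChar (↥(maximalRealSubfield L)) ψ := ⟨hψc, hψF, hψ1⟩
  have hTate := hψg.exists_eq_mulShift_adeleAddChar
  obtain ⟨ξ, hξ, hψ⟩ := hTate
  have hψ₀ := isGlobalAddChar_adeleAddChar (↥(maximalRealSubfield L))
  -- (2) the rescaled skew-Hermitian space `(V, ξΦ)`
  have hΦ₁' := smul_form_linear_left (↥(maximalRealSubfield L)) L V Φ (ξ := ξ) hΦ₁
  have hΦ₂' := smul_form_semilinear_right (↥(maximalRealSubfield L)) L V Φ (ξ := ξ) (IsCMField.complexConj L) hΦ₂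
  have hΦ₃' := smul_form_skew (↥(maximalRealSubfield L)) L V Φ (ξ := ξ) (IsCMField.complexConj L) hΦ₃
  have hφ' := nondegenerate_traceForm_smul (↥(maximalRealSubfield L)) L V Φ hξ hφ
  -- (3) a `ξΦ`-orthogonal basis with purely imaginary diagonal, and the line enumeration
  have hbasis := exists_orthogonal_basis_imaginary (↥(maximalRealSubfield L)) L (IsCMField.complexConj L)
    (complexConj_imagUnit L) (imagUnit_ne_zero L) (imagUnit_mul_self L) (ξ • Φ) hΦ₁' hΦ₃'
  obtain ⟨b, f, hb, hf⟩ := hbasis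
  let e : Fin (finrank L V) × Fin 1 ≃ Fin (finrank L V) := Equiv.prodUnique (Fin (finrank L V)) (Fin 1)
  have he : ∀ k : Fin (finrank L V), (e.symm k).1 = k := fun k => rfl
  -- (4) a Haar measure on `𝐀_Fⁿ` and the `L²` model of `(V, ξΦ)` in the Darboux frame of `b`
  letI : MeasurableSpace (AdeleRing (𝓞 ↥(maximalRealSubfield L)) ↥(maximalRealSubfield L)) := borel _
  haveI : BorelSpace (AdeleRing (𝓞 ↥(maximalRealSubfield L)) ↥(maximalRealSubfield L)) := ⟨rfl⟩
  haveI : SecondCountableTopology (AdeleRing (𝓞 ↥(maximalRealSubfield L)) ↥(maximalRealSubfield L)) :=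
    secondCountableTopology_adeleRing _
  haveI : LocallyCompactSpace (AdeleRing (𝓞 ↥(maximalRealSubfield L)) ↥(maximalRealSubfield L)) :=
    locallyCompactSpace_adeleRing' _
  haveI : BorelSpace (Fin (finrank L V) → AdeleRing (𝓞 ↥(maximalRealSubfield L)) ↥(maximalRealSubfield L)) :=
    Pi.borelSpace
  let ν : Measure (Fin (finrank L V) → AdeleRing (𝓞 ↥(maximalRealSubfield L)) ↥(maximalRealSubfield L)) :=
    Measure.addHaarMeasure (Classical.arbitrary _)
  have hψc₀ : Continuous (adeleAddChar ↥(maximalRealSubfield L) :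
      AdeleRing (𝓞 ↥(maximalRealSubfield L)) ↥(maximalRealSubfield L) → Circle) := hψ₀.continuous
  have hβc := continuous_adelicForm_left (↥(maximalRealSubfield L)) (Fin (finrank L V))
    (1 : Matrix (Fin (finrank L V)) (Fin (finrank L V)) (AdeleRing (𝓞 ↥(maximalRealSubfield L)) ↥(maximalRealSubfield L)))
  -- (5) the body of Prop. 3.1.1 for the `L²` model of `(V, ξΦ)` (third hand's all-signature form of GR-2's `prop311_CM_L2`,
  --     its irreducibility input discharged by `Prop311RhoPsiL2Frame`)
  have hL := prop311_CM_L2' L f e he V b (ξ • Φ) hΦ₁' hΦ₂' hb hf hφ' ν hψc₀ hβc hΦ₃'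
  obtain ⟨iL, hiL, -, hL'⟩ := hL
  -- (6) the rescaled model `ρ ∘ τ_ξ` (central character `ψ_F`) and a rational splitting for it
  have hmodel := comp_heisTwist_printed_binders hξ ρ ψ (adeleAddChar ↥(maximalRealSubfield L)) hψ hρu hρc hρi hρz
  obtain ⟨hρ'u, hρ'c, hρ'i, hρ'z⟩ := hmodel
  have hsplit := exists_isRationalSplitting_smul hξ ρ i hi
  obtain ⟨i', hi'⟩ := hsplit
  -- (7) uniqueness of `ρ_ψ`: the body for the `L²` model gives it for `ρ ∘ τ_ξ`
  haveI : Nontrivial (Lp ℂ 2 ν) := nontrivial_L2_adele ν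
  have h7 := conclusion_of_conclusion (↥(maximalRealSubfield L)) L V (ξ • Φ) (IsCMField.complexConj L)
    (adeleAddChar ↥(maximalRealSubfield L)) hψc₀ hψ₀.map_algebraMap hψ₀.ne_one hΦ₃' hφ' S _ hρ'u hρ'c hρ'i hρ'z i' hi'
    (Lp ℂ 2 ν) (cmL2Model L f e he V b (ξ • Φ) hΦ₁' hΦ₂' hb hf hφ' ν hψc₀ hβc)
    (norm_cmL2Model L f e he V b (ξ • Φ) hΦ₁' hΦ₂' hb hf hφ' ν hψc₀ hβc)
    (continuous_rep_comp_toCoordHeisenberg _ _ (adeleAddChar ↥(maximalRealSubfield L)) hψc₀ hβc ν)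
    (irreducible_rep_comp_toCoordHeisenberg _ _ (adeleAddChar ↥(maximalRealSubfield L)) hψc₀ hβc ν hψ₀)
    (rep_comp_toCoordHeisenberg_ofCenter _ _ (adeleAddChar ↥(maximalRealSubfield L)) hψc₀ hβc ν) iL hiL hL'
  -- (8) undo the rescaling
  exact conclusion_of_conclusion_smul hξ ρ (IsCMField.complexConj L) hΦ₃ hφ hρu hρi i hi i' hi' h7

end Prop311

end Literature.NumberTheory.GelbartRogawski1991

end
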